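import Summits.HubbardSuperconductivity.HubbardSuperconductivity.Theorems.BirComplexStableXY.Negative.WitnessTable
import Literature.MathematicalPhysics.QuantumFieldTheory.TorusChartCochains
import HarnessLib

/-!
# Crux `BirComplexStableXYR`, line `fat-gaussian-defect-calculus`: stub R12 `stub_pathCfg_osc`

Registered stub (lead c7, skeleton `Cruxes/BirComplexStableXYR/Lines/fat_gaussian_defect_calculus.lean`), helper
(`--supports`) for the crux `Summit.HubbardSuperconductivity.HubbardSuperconductivity.Theses.BalabanIR.BirComplexStableXYR`:
**the oscillation of a window path configuration is controlled by the bond gradients.**  On the engine's torus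
`Λ L M = (Fin 2 → ZMod L) × ZMod M` with the space–time chart `TorusChart.piProdZMod 2 L M`, the window path
configuration `P η s : W r → ℝ` is the staircase sum of the real `1`-cochain `η` inside the window with corner `s`
(`w.1` edges in direction `0`, then `w.2.1` in direction `1`, then `w.2.2` in direction `2`).  If every value of `η`
has modulus at most `m`, then any two values of `P η s` differ by at most `6(r−1)·m`.

Proof: a line sum of `n` edges has modulus `≤ n·m` (`Finset.abs_sum_le_sum_abs`, `Finset.sum_le_sum`,
`Finset.sum_const`, `Finset.card_range`); each of the three staircase lengths is a `Fin r`, hence `≤ r − 1`; so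
`|P η s w| ≤ 3(r−1)·m` and `|P η s w − P η s w'| ≤ |P η s w| + |P η s w'| ≤ 6(r−1)·m`.  No definitions; sorry-free.
-/

set_option linter.dupNamespace false -- summit = problem name (single-conjunct summit), D-0017

namespace Summit.HubbardSuperconductivity.HubbardSuperconductivity.Theorems.FSUnfolding

open scoped BigOperators
open Literature.MathematicalPhysics.QuantumFieldTheory Literature.Probability.LatticeModels
open Summit.HubbardSuperconductivity.BirComplexStableXYNegative

/-- **Modulus of a line sum** (any charted torus).  If every value of the real `1`-cochain `η` has modulus at most
`m`, the line sum of `η` along `n` consecutive edges has modulus at most `n·m`. [folklore] -/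
theorem abs_lineSum_le_length_mul {Λ : Type*} [AddCommGroup Λ] {d : ℕ} (F : TorusChart Λ d)
    (η : Λ → Fin d → ℝ) (m : ℝ) (hm : ∀ (x : Λ) (i : Fin d), |η x i| ≤ m) (i : Fin d) (n : ℕ) (y : Λ) :
    |F.lineSum η i n y| ≤ (n : ℝ) * m := by
  unfold TorusChart.lineSum
  calc |∑ k ∈ Finset.range n, η (y + k • F.gen i) i|
      ≤ ∑ k ∈ Finset.range n, |η (y + k • F.gen i) i| := Finset.abs_sum_le_sum_abs _ _
    _ ≤ ∑ _k ∈ Finset.range n, m := Finset.sum_le_sum fun k _ => hm _ _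
    _ = (n : ℝ) * m := by rw [Finset.sum_const, Finset.card_range, nsmul_eq_mul]

/-- **A staircase length is at most `r − 1`.**  Every `j : Fin r` satisfies `(j : ℝ) ≤ r − 1`. [folklore] -/
theorem natCast_fin_le_sub_one {r : ℕ} (j : Fin r) : ((j : ℕ) : ℝ) ≤ (r : ℝ) - 1 := by
  have h : (j : ℕ) + 1 ≤ r := j.isLt
  have h' : ((j : ℕ) : ℝ) + 1 ≤ (r : ℝ) := by exact_mod_cast h
  linarith

/-- **Stub R12 `stub_pathCfg_osc` (registered signature, verbatim): oscillation of window path configurations is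
controlled by the bond gradients.**  If every value of the `1`-cochain `η` is at most `m` in modulus, two values of
the window path configuration `P η s` differ by at most `6(r−1)·m` (each staircase has at most `3(r−1)` edges, each
line sum of `n` edges has modulus `≤ n·m`, `abs_add_three` and `|a − b| ≤ |a| + |b|`).  So a "rough window" (oscillation `≥ p`)
contains a bond with `|η_b| ≥ p/(6(r−1))`. [folklore] -/
theorem stub_pathCfg_osc :
    ∀ (r L M : ℕ) [NeZero L] [NeZero M]
      (P : (Λ L M → Fin 3 → ℝ) → Λ L M → W r → ℝ),
      (∀ (ω : Λ L M → Fin 3 → ℝ) (s : Λ L M) (w : W r), P ω s w =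
        (TorusChart.piProdZMod 2 L M).lineSum ω 0 (w.1 : ℕ) s
          + (TorusChart.piProdZMod 2 L M).lineSum ω 1 (w.2.1 : ℕ) (s + (w.1 : ℕ) • (TorusChart.piProdZMod 2 L M).gen 0)
          + (TorusChart.piProdZMod 2 L M).lineSum ω 2 (w.2.2 : ℕ)
            (s + (w.1 : ℕ) • (TorusChart.piProdZMod 2 L M).gen 0 + (w.2.1 : ℕ) • (TorusChart.piProdZMod 2 L M).gen 1)) →
      ∀ (η : Λ L M → Fin 3 → ℝ) (m : ℝ), (∀ (x : Λ L M) (i : Fin 3), |η x i| ≤ m) →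
      ∀ (s : Λ L M) (w w' : W r), |P η s w - P η s w'| ≤ 6 * ((r : ℝ) - 1) * m := by
  intro r L M _ _ P hP η m hm s w w'
  -- `m` is nonnegative: it dominates a modulus.
  have hm0 : 0 ≤ m := (abs_nonneg _).trans (hm s 0)
  -- Each value of the window path configuration has modulus at most `3(r−1)·m`.
  have hbound : ∀ v : W r, |P η s v| ≤ 3 * ((r : ℝ) - 1) * m := by
    intro v
    rw [hP]
    have h1 := abs_lineSum_le_length_mul (TorusChart.piProdZMod 2 L M) η m hm 0 (v.1 : ℕ) s
    have h2 := abs_lineSum_le_length_mul (TorusChart.piProdZMod 2 L M) η m hm 1 (v.2.1 : ℕ)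
      (s + (v.1 : ℕ) • (TorusChart.piProdZMod 2 L M).gen 0)
    have h3 := abs_lineSum_le_length_mul (TorusChart.piProdZMod 2 L M) η m hm 2 (v.2.2 : ℕ)
      (s + (v.1 : ℕ) • (TorusChart.piProdZMod 2 L M).gen 0 + (v.2.1 : ℕ) • (TorusChart.piProdZMod 2 L M).gen 1)
    have hv1 : ((v.1 : ℕ) : ℝ) * m ≤ ((r : ℝ) - 1) * m :=
      mul_le_mul_of_nonneg_right (natCast_fin_le_sub_one v.1) hm0
    have hv2 : ((v.2.1 : ℕ) : ℝ) * m ≤ ((r : ℝ) - 1) * m :=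
      mul_le_mul_of_nonneg_right (natCast_fin_le_sub_one v.2.1) hm0
    have hv3 : ((v.2.2 : ℕ) : ℝ) * m ≤ ((r : ℝ) - 1) * m :=
      mul_le_mul_of_nonneg_right (natCast_fin_le_sub_one v.2.2) hm0
    refine (abs_add_three _ _ _).trans ?_
    linarith
  calc |P η s w - P η s w'|
      ≤ |P η s w| + |P η s w'| := abs_sub _ _
    _ ≤ 3 * ((r : ℝ) - 1) * m + 3 * ((r : ℝ) - 1) * m := add_le_add (hbound w) (hbound w')
    _ = 6 * ((r : ℝ) - 1) * m := by ring

end Summit.HubbardSuperconductivity.HubbardSuperconductivity.Theorems.FSUnfolding
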